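import Literature.AlgebraicGeometry.HodgeTheory.UnramifiedTorsionFree
import Literature.AlgebraicGeometry.HodgeTheory.BettiTorsionDiesGenerically

/-!
# The two transcriptions of Colliot-Thélène–Voisin 2012, Théorème 3.1, compared

Two named facts render the same printed theorem (Duke 161 (2012) = arXiv:1005.2778, Théorème 3.1:
the Zariski sheaves `𝓗ᵖ_X(ℤ(i))` are torsion-free):

* `ColliotTheleneVoisin2012_thm31_stalkTorsionFree` (`UnramifiedTorsionFree.lean`): the STALKWISE
  form, all degrees `q`, at every prescribed point `x ∉ Z`;
* `ColliotTheleneVoisin2012_torsionDiesGenerically` (`BettiTorsionDiesGenerically.lean`): the middle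
  degree `2p` of a `2p`-fold, some smaller non-empty open (no point prescribed) — the body of route item
  `GenericDivisibility.TorsionDiesGenerically`.

This file records that the first implies the second (pick any point outside `Z ≠ univ`), so the two
entries carry ONE unit of independent literature debt. [cite: ColliotTheleneVoisin2012, Théorème 3.1]
-/

namespace Literature.AlgebraicGeometry.HodgeTheory

open Literature.AlgebraicGeometry.Motives Literature.AlgebraicTopology.SingularHomology

/-- The stalkwise torsion-freeness of `𝓗^q_X(ℤ)` (all degrees, prescribed point) implies the
middle-degree "torsion dies on a smaller non-empty Zariski open" form: choose a point outside
`Z ≠ univ` and forget it. [cite: ColliotTheleneVoisin2012, Théorème 3.1] -/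
theorem ColliotTheleneVoisin2012_torsionDiesGenerically_of_thm31
    (hf : ColliotTheleneVoisin2012_thm31_stalkTorsionFree) :
    ColliotTheleneVoisin2012_torsionDiesGenerically := by
  intro p X hp hX Z hZ hZu w N hN hw
  obtain ⟨x, hx⟩ := (Set.ne_univ_iff_exists_notMem Z).1 hZu
  obtain ⟨Z', h, hZ', hxZ', h0⟩ := hf hX (2 * p) Z hZ w N hN hw x hx
  exact ⟨Z', h, hZ', fun huniv => hxZ' (huniv ▸ Set.mem_univ x), h0⟩

end Literature.AlgebraicGeometry.HodgeTheory
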